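import Mathlib
import HarnessLib
import Summits.HubbardSuperconductivity.HubbardSuperconductivity.Theorems.KLProgrammeSWaveCascadeArrayEdge
import Summits.HubbardSuperconductivity.HubbardSuperconductivity.Theorems.KLProgrammeKLRegimeSplitPairArrayEdge
import Summits.HubbardSuperconductivity.HubbardSuperconductivity.Theorems.KLProgrammeKLRegimeWickOrderedStep

/-!
# Route `KLProgramme` — row 0′ (child 1) on the WICK-ORDERED carrier: the envelope of the Wick pair amplitudes `𝒞^W_n(Qm; k, k′)`
# (`KLRegimeWick.klWickPairAmplitude`, p1 g8 p481972) from (E2-v8)-shaped signed ladder steps and (E2″)-shaped gained increments ON THAT CARRIER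

Cell gate-hubbard-kl, seat hubbard-kl-k3c1-p2 (child-1 re-closure owner; technique «row-0′ V4/S twin induction measured from its own constant»).
Context: p1 g8's E2-STRUCTURE-NOTE (evidence #12 on stmt-HubbardSuperconductivity-19855, sha16 0e503bca3287cbfe): on the plain carrier the (E2-v8)
step at precision `2^{−n}` needs the ladder-tree structure of `W₆^{(n−1)}`; on the Wick-ordered action `𝒲_n = e^{Δ_{D_n}}𝒱_n` the step has no
first-order term and closes on quartic data; options (A) engine-private Wick invariant, (B) value clauses re-typed on the Wick carrier, (C) private.
Under EACH option an s-wave envelope of the Wick pair amplitudes has to be propagated across the scales from Wick ladder steps — this is row 0′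
verbatim on another carrier, so it is supplied here BY INSTANCE of the carrier-generic `amplitudeArray_envelope_edge` (`…SWaveCascadeArrayEdge`):
**`wickPairArray_envelope_edge`** = `pairArray_envelope_edge` (p473743) with `klPairAmplitude ↦ klWickPairAmplitude` and the ball-truncated array
written out (`Matrix.of (fun s t => if s ∈ klBall ∧ t ∈ klBall then 𝒞^W_{j−1}(Qm; s, t) else 0)` — no new definition), hypotheses in the
(E2-v8)/(E2″-v6) clause SHAPES (UV deviation `initDevBar + X₀`; in-class signed steps with `Σ|w| ≤ bhi`, `Σ(|w| − w) ≤ δ_j(Qm)`, right inverse,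
bound `drivePBar + eremBar + X_j`; increments `gainBar + eremBar + X_j`), the negative-mass line at every in-class scale and the no-onset smallness;
conclusion `∃ u ∈ [0, (16/15)·U]`, `‖𝒞^W_n(Qm;k,k′) − u‖ ≤ 12·((initDevBar + Σ(drivePBar+ē) + Xtot) + (Σ(drivePBar+ē) + Xsup)) + ((Klam U)²·3CF + Xtot + Σē)`
on the ball — the SAME numbers as on the plain carrier.  Nothing here asserts that the Wick amplitudes satisfy the hypotheses (that is the engine's
Wick invariant); no clause text is proposed; nothing asserts superconductivity.  Everything is proved; no definitions.
-/

noncomputable section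

namespace Summit.HubbardSuperconductivity.HubbardSuperconductivity.Theorems.KLRegimeSplit

set_option linter.dupNamespace false -- summit = problem name (single-conjunct summit), D-0017

open Finset Literature.MathematicalPhysics.QuantumLattice Literature.Probability.LatticeModels
open Summit.HubbardSuperconductivity.HubbardSuperconductivity.Theorems.KLProgrammeLegKernels
open Summit.HubbardSuperconductivity.HubbardSuperconductivity.Theorems.CooperChannelRiccatiFlow
open Summit.HubbardSuperconductivity.HubbardSuperconductivity.Theorems.SWaveCascade
open Summit.HubbardSuperconductivity.HubbardSuperconductivity.Theorems.KLRegimeWick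

section Model

variable (L M : ℕ) [NeZero L] [NeZero M]

variable {G : GeoConsts} {P : SplitConsts} {Qc : EngConsts}

/-- **Row 0′ on the Wick-ordered carrier, every total momentum.**  The statement of `pairArray_envelope_edge` with the Wick pair amplitudes
`klWickPairAmplitude` in place of `klPairAmplitude` (the truncated array written out); see the module docstring. -/
theorem wickPairArray_envelope_edge (hG : G.WF) (hP : P.WF) (hQc : Qc.WF) {β U μ : ℝ} {K : TrigPolyC4v} (hU : 0 ≤ U)
    {n : ℕ} (X : ℕ → TorusSite 2 L → TorusSite 2 L → TorusSite 2 L → ℝ) {Xtot Xsup : ℝ}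
    (hX0 : ∀ j Qm k k', 0 ≤ X j Qm k k') (hXtot0 : 0 ≤ Xtot) (hXsup0 : 0 ≤ Xsup)
    (hXsup : ∀ j Qm k k', X j Qm k k' ≤ Xsup)
    (hXsum : ∀ (t : ℕ) (Qm k k' : TorusSite 2 L), ∑ j ∈ Ioc t n, X j Qm k k' ≤ Xtot)
    (hXtot : ∀ Qm k k' : TorusSite 2 L, X 0 Qm k k' + ∑ i ∈ range n, X (i + 1) Qm k k' ≤ Xtot)
    (δ : ℕ → TorusSite 2 L → ℝ)
    (hneg : ∀ Qm : TorusSite 2 L, ∀ t ≤ n, IsPairClassAt L Qm t → 16 * U * ∑ i ∈ range t, δ (i + 1) Qm ≤ 1)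
    (h0 : ∀ Qm : TorusSite 2 L, ∀ k ∈ klBall L μ K, ∀ k' ∈ klBall L μ K,
      ‖klWickPairAmplitude L M β U μ K 0 Qm k k' - (U : ℂ)‖ ≤ initDevBar G U + X 0 Qm k k')
    (hsteps : ∀ j, 1 ≤ j → j ≤ n → ∀ Qm : TorusSite 2 L, IsPairClassAt L Qm j →
      ∃ w : TorusSite 2 L → ℝ, (∑ p, |w p| ≤ G.bhi) ∧ (∑ p, (|w p| - w p) ≤ δ j Qm) ∧
        ∃ N : Matrix (TorusSite 2 L) (TorusSite 2 L) ℂ,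
          (1 + Matrix.diagonal (fun p => (w p : ℂ)) *
              Matrix.of (fun s t => if s ∈ klBall L μ K ∧ t ∈ klBall L μ K then
                klWickPairAmplitude L M β U μ K (j - 1) Qm s t else 0)) * N = 1 ∧
          ∀ k ∈ klBall L μ K, ∀ k' ∈ klBall L μ K,
            ‖klWickPairAmplitude L M β U μ K j Qm k k' -
                (Matrix.of (fun s t => if s ∈ klBall L μ K ∧ t ∈ klBall L μ K then
                  klWickPairAmplitude L M β U μ K (j - 1) Qm s t else 0) * N) k k'‖ ≤
              drivePBar G P U (j - 1) + eremBar G P Qc U β L (j - 1) + X j Qm k k')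
    (hincr : ∀ j, 1 ≤ j → j ≤ n → ∀ Qm : TorusSite 2 L, ∀ k ∈ klBall L μ K, ∀ k' ∈ klBall L μ K,
      ‖klWickPairAmplitude L M β U μ K j Qm k k' - klWickPairAmplitude L M β U μ K (j - 1) Qm k k'‖ ≤
        gainBar G P U j (klTorusNorm L Qm) (klTorusNorm L (k - k')) (klTorusNorm L (k + k' - Qm)) +
          eremBar G P Qc U β L (j - 1) + X j Qm k k')
    (Qm : TorusSite 2 L)
    (hsmall : 8 * 42 * ((initDevBar G U + ∑ j ∈ range n, (drivePBar G P U j + eremBar G P Qc U β L j) + Xtot) +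
        (∑ j ∈ range n, (drivePBar G P U j + eremBar G P Qc U β L j) + Xsup)) * (G.bhi * n) ≤ 1) :
    ∃ u : ℝ, 0 ≤ u ∧ u ≤ 16 / 15 * U ∧ ∀ k ∈ klBall L μ K, ∀ k' ∈ klBall L μ K,
      ‖klWickPairAmplitude L M β U μ K n Qm k k' - (u : ℂ)‖ ≤
        12 * ((initDevBar G U + ∑ j ∈ range n, (drivePBar G P U j + eremBar G P Qc U β L j) + Xtot) +
          (∑ j ∈ range n, (drivePBar G P U j + eremBar G P Qc U β L j) + Xsup)) +
        ((P.Klam * U) ^ 2 * (3 * G.CF) + Xtot + ∑ i ∈ range n, eremBar G P Qc U β L i) := by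
  classical
  have hG' := hG
  obtain ⟨-, -, -, -, -, -, -, -, -, -, -, hpp0, hph0, hCF, hphsum, hppsum, -⟩ := hG'
  have hbhi : 0 ≤ G.bhi := hG.2.2.1.trans hG.2.2.2.1
  have hinit0 : 0 ≤ initDevBar G U := by
    unfold initDevBar
    refine mul_nonneg (add_nonneg (sum_nonneg fun χ _ => add_nonneg (hG.2.1 χ) (hG.1 χ)) zero_le_one) (sq_nonneg U)
  have hGtot0 : 0 ≤ (P.Klam * U) ^ 2 * (3 * G.CF) := by positivity
  -- the frozen-gain line past the class exit, from `G.WF`'s gain sums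
  have hg : ∀ t ≤ n, ¬ IsPairClassAt L Qm (t + 1) → ∀ k ∈ klBall L μ K, ∀ k' ∈ klBall L μ K,
      ∑ j ∈ Ioc t n, gainBar G P U j (klTorusNorm L Qm) (klTorusNorm L (k - k')) (klTorusNorm L (k + k' - Qm)) ≤
        (P.Klam * U) ^ 2 * (3 * G.CF) := by
    intro t _ hexit k _ k' _
    have hexit' : ((4 : ℝ) ^ (t + 1))⁻¹ < klTorusNorm L Qm := lt_of_not_ge hexit
    have h1 : ∑ j ∈ Ioc t n, G.ppGain j (klTorusNorm L Qm) ≤ G.CF := hppsum _ t n hexit'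
    have hsub : ∀ ρ : ℝ, ∑ j ∈ Ioc t n, G.phGain j ρ ≤ ∑ j ∈ range (n + 1), G.phGain j ρ := fun ρ =>
      sum_le_sum_of_subset_of_nonneg (fun j hj => by simp only [mem_Ioc] at hj; exact mem_range.2 (by omega)) fun j _ _ => hph0 j ρ
    have h2 : ∑ j ∈ Ioc t n, G.phGain j (klTorusNorm L (k - k')) ≤ G.CF :=
      (hsub _).trans (hphsum _ (n + 1) (torusSupNorm_nonneg _))
    have h3 : ∑ j ∈ Ioc t n, G.phGain j (klTorusNorm L (k + k' - Qm)) ≤ G.CF :=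
      (hsub _).trans (hphsum _ (n + 1) (torusSupNorm_nonneg _))
    simp only [gainBar, ← mul_sum, sum_add_distrib]
    nlinarith [h1, h2, h3, sq_nonneg (P.Klam * U)]
  exact amplitudeArray_envelope_edge (klBall L μ K) (fun j => klWickPairAmplitude L M β U μ K j Qm) (IsPairClassAt L Qm)
    (fun h hjm => isPairClassAt_mono L h hjm) hU hbhi hinit0 hGtot0
    (fun j => drivePBar G P U j + eremBar G P Qc U β L j) (fun j => eremBar G P Qc U β L j)
    (fun j => add_nonneg (drivePBar_nonneg' hG U j) (eremBar_nonneg' hG hP hQc U β L j))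
    (fun j => eremBar_nonneg' hG hP hQc U β L j)
    (fun j k k' => gainBar G P U j (klTorusNorm L Qm) (klTorusNorm L (k - k')) (klTorusNorm L (k + k' - Qm)))
    (fun j => X j Qm) (fun j k k' => hX0 j Qm k k') hXtot0 hXsup0 (fun j k k' => hXsup j Qm k k') (fun t k k' => hXsum t Qm k k')
    (fun k k' => hXtot Qm k k') (fun j => δ j Qm) (hneg Qm) (h0 Qm)
    (fun j hj1 hjn hQj => hsteps j hj1 hjn Qm hQj) (fun j hj1 hjn k hk k' hk' => hincr j hj1 hjn Qm k hk k' hk') hg hsmall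

end Model

end Summit.HubbardSuperconductivity.HubbardSuperconductivity.Theorems.KLRegimeSplit

end
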